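import Summits.BirchSwinnertonDyer.BirchSwinnertonDyer.Theorems.SemiOrdinaryEisensteinDescentCasselsTateGlobalTransport
import Summits.BirchSwinnertonDyer.BirchSwinnertonDyer.Theorems.SemiOrdinaryEisensteinDescentCasselsTateWeilSemilinear
import Summits.BirchSwinnertonDyer.BirchSwinnertonDyer.Theorems.SemiOrdinaryEisensteinDescentCasselsTateLevelInputsOfPoitouTateAt
import Summits.BirchSwinnertonDyer.BirchSwinnertonDyer.Theorems.AdditiveKolyvaginRoadShaEigenParity
import Literature.NumberTheory.GaloisCohomology.PoitouTateNumberField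
import HarnessLib

/-!
# `Aut(K/ℚ)`-invariance of Milne's general-case Cassels–Tate value for THE invariant maps — conjunct (v) of
# `casselsTate_levelInputs` DISCHARGED; the levelwise Cassels–Tate fact ⟸ {I 4.10(a) cochain form} + Poitou–Tate AT `E[p^{M₀}]`

Route `SemiOrdinaryEisensteinDescent` (BSD, rung W-ALL row 2·3@3), Kolyvagin column: print item
`CasselsTateLevelInputsFact` (stmt-BirchSwinnertonDyer-20191 = `∀ K, casselsTate_levelInputs K`, conjunct 1 of
`KolyvaginPrimitivesAtThree` stmt-25896 = the `closes` binder `hPr`; also the `hCT`/`hCT3` binders of KolyvaginRoadThree,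
ClassRecordThree, ErratumRoadFive). Width seat `bsd-wall-soed-p2-w3` g5; `--supports stmt-BirchSwinnertonDyer-20480`, helper.

THEOREMS ONLY. Nothing here proves a case of BSD or of Poitou–Tate duality.

* `ctGeneralFun_conjAct_canonical` — **for every number field `K`, every `E = W/ℚ`, every odd level `m ≥ 2`, every
  `σ ∈ Aut(K/ℚ)`, every biadditive alternating `Γ_K`-equivariant `μ_{m²}`-valued pairing `e` on `E[m²](K̄)` and ALL
  `z, t ∈ H¹(K, E[m²])`:
  `ctGeneralFun (σ_* z̄, σ_* t̄) = ctGeneralFun (z̄, t̄)` for `inv = LocalInvariants.canonical K (m·m)`** (Milne's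
  general-case value, *ADT* I Prop. 6.9; Gross 1991 §5 (5.1); McCallum 1991 §5). Proof = the four landed steps: (A) inner
  invariance of the local terms (p622333), (B) semilinear transport of the local data along the adapted lifts with
  `inv_{σv} ∘ σ_* = inv_v` (p622709), (C) global transport `D ↦ D^σ` with `t_{σv}(D^σ) = t_v(D)`, `t_∞ = 0` (p623439),
  (E) `e(τS, τT) = τ e(S, T)` for every lift (p624008); then well-definedness (`ctGeneralFun_eq`) and re-indexing of
  the finite sum of local terms along `v ↦ σ v`; the «no data» case by `σ⁻¹`.
* `casselsTate_levelInputs_of_hPTc_of_selmerComplementAt` / `…_of_middleExactAt` — w3 g4's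
  `casselsTate_levelInputs_of_hPTc_of_hconj_of_selmerComplementAt` / `…_of_middleExactAt` (p619177) with the displayed
  `hconj` DISCHARGED: **`casselsTate_levelInputs K` ⟸ `hPTc` (Milne I 4.10(a) for `Ш²(K, E[q])`, cochain form) + Howard (i) /
  Milne I 4.10(b) AT the modules `E[p^{M₀}]` for THE maps, ONLY.** Of w2 g2's four displayed residuals
  {hH3, hPTc, h615, hconj} of `casselsTate_levelInputs_of_canonical_inputs`, three are now theorems or per-module PT.

## References

* [MilneADT2006] J. S. Milne, *Arithmetic Duality Theorems*, 2nd ed. (2006), Ch. I §6, Prop. 6.9, Thm. 6.13; Thm. 4.10.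
* [GrossLMS1991] B. H. Gross, *Kolyvagin's work on modular elliptic curves* (1991), §5 (5.1).
* [McCallumLMS1991] W. G. McCallum, *Kolyvagin's work on Shafarevich–Tate groups* (1991), §5, Thms. 5.4, 5.8.
* [CasselsFrohlichANT1967] Cassels–Fröhlich (eds.), *Algebraic Number Theory* (1967), Ch. VI §1.1, VII §1.1.
-/

noncomputable section

open scoped Classical

-- the Theorems namespace of this sub repeats the summit name by design (D-0017 nested layout)
set_option linter.dupNamespace false
set_option autoImplicit false

namespace Summit.BirchSwinnertonDyer.BirchSwinnertonDyer.Theorems.CasselsTateConj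

open CategoryTheory _root_.WeierstrassCurve Field Function NumberField IsDedekindDomain
open Literature.NumberTheory.EllipticCurves Literature.NumberTheory.Automorphic
open Literature.NumberTheory.GaloisRepresentations Literature.NumberTheory.GaloisCohomology
open Literature.NumberTheory.GaloisRepresentations.DiscreteGaloisModule (mu MuCarrier pairing SelmerStructure
  unramifiedSubgroup localTatePairingZMod tateDual)
open Summit.BirchSwinnertonDyer.BirchSwinnertonDyer.Theorems.AdditiveKoly (torsionH1ToH1_conjAct)
open Summit.BirchSwinnertonDyer.BirchSwinnertonDyer.Theorems.CasselsTateLemma615OfPT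

/-! ## The invariance -/

section Invariance

variable {K : Type} [Field K] [NumberField K] (W : WeierstrassCurve ℚ) (m : ℕ) [NeZero m]
variable (e : geomTorsion (W.baseChange K) ((m * m : ℕ) : ℤ) → geomTorsion (W.baseChange K) ((m * m : ℕ) : ℤ) →
    AlgebraicClosure K)
  (hμ : ∀ S T, e S T ^ (m * m) = 1)
  (hadd₁ : ∀ S₁ S₂ T, e (S₁ + S₂) T = e S₁ T * e S₂ T)
  (hadd₂ : ∀ S T₁ T₂, e S (T₁ + T₂) = e S T₁ * e S T₂)
  (hgal : ∀ (g : absoluteGaloisGroup K) (S T : geomTorsion (W.baseChange K) ((m * m : ℕ) : ℤ)),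
    g • e S T = e (g • S) (g • T))

variable {W m e hμ hadd₁ hadd₂ hgal}

/-- **`Aut(K/ℚ)`-invariance of Milne's general-case Cassels–Tate value for THE invariant maps**: for `m` odd, `m ≥ 2`,
every `σ ∈ Aut(K/ℚ)` and all `z, t ∈ H¹(K, E[m²])`,
`ctGeneralFun(σ_* z̄, σ_* t̄) = ctGeneralFun(z̄, t̄)` (`z̄` the image in `H¹(K, E)`, `inv = LocalInvariants.canonical K (m·m)`).
If finitely supported data `D` for `(z̄, t̄)` exist, the transported data `D^σ` (`exists_semilinearTransport`, with
`e(τS, τT) = τ e(S, T)` from `weilType_semilinear`) are finitely supported data for `(σ_* z̄, σ_* t̄)`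
(`torsionH1ToH1_conjAct`) and `∑_v t_v(D^σ) = ∑_v t_v(D)` by re-indexing along `v ↦ σ v` (finite places) — the
infinite places contribute `0`; both values are these sums (`ctGeneralFun_eq`). If no such data exist for `(z̄, t̄)`
then none exist for `(σ_* z̄, σ_* t̄)` (transport back by `σ⁻¹`) and both values are `0`.
[cite: MilneADT2006, Ch. I §6, Prop. 6.9] [cite: GrossLMS1991, §5 (5.1)] [cite: McCallumLMS1991, §5, Thm. 5.4, Thm. 5.8] -/
theorem ctGeneralFun_conjAct_canonical [W.IsElliptic] (hodd : Odd m) (hm : 2 ≤ m) (halt : ∀ T, e T T = 1)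
    (σ : K ≃ₐ[ℚ] K) (z t : galH1Torsion (W.baseChange K) ((m * m : ℕ) : ℤ)) :
    ctGeneralFun (W.baseChange K) m e hμ hadd₁ hadd₂ hgal (LocalInvariants.canonical K (m * m))
        (torsionH1ToH1 (W.baseChange K) _ (conjAct W σ _ z)) (torsionH1ToH1 (W.baseChange K) _ (conjAct W σ _ t)) =
      ctGeneralFun (W.baseChange K) m e hμ hadd₁ hadd₂ hgal (LocalInvariants.canonical K (m * m))
        (torsionH1ToH1 (W.baseChange K) _ z) (torsionH1ToH1 (W.baseChange K) _ t) := by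
  have hPT' : (LocalInvariants.canonical K (m * m)).SumInvLocalizationEqZero :=
    sumInvLocalizationEqZero_canonical_of_numberField K _
  have he : ∀ (σ' : K ≃ₐ[ℚ] K) (τ' : AlgebraicClosure K ≃+* AlgebraicClosure K) (hτ' : IsLiftOfAut σ' τ')
      (S T : geomTorsion (W.baseChange K) ((m * m : ℕ) : ℤ)),
      e (hτ'.torsionMap W _ S) (hτ'.torsionMap W _ T) = τ' (e S T) := fun σ' τ' hτ' S T =>
    weilType_semilinear W (m * m) (hm.trans (Nat.le_mul_self m)) e hμ hadd₁ hadd₂ halt hτ' S T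
  -- transfer of finitely supported data along `σ'`, with equality of the values
  have transfer : ∀ (σ' : K ≃ₐ[ℚ] K) (z t : galH1Torsion (W.baseChange K) ((m * m : ℕ) : ℤ)),
      (∃ D : GeneralCaseData (W.baseChange K) m e hμ hadd₁ hadd₂ hgal,
        torsionH1ToH1 (W.baseChange K) (m : ℤ) D.b = torsionH1ToH1 (W.baseChange K) _ z ∧
        torsionH1ToH1 (W.baseChange K) (m : ℤ) D.b' = torsionH1ToH1 (W.baseChange K) _ t ∧
        ∃ S : Finset (Place K), ∀ v ∉ S, D.localTerm (LocalInvariants.canonical K (m * m)) v = 0) →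
      (∃ D : GeneralCaseData (W.baseChange K) m e hμ hadd₁ hadd₂ hgal,
        torsionH1ToH1 (W.baseChange K) (m : ℤ) D.b = torsionH1ToH1 (W.baseChange K) _ (conjAct W σ' _ z) ∧
        torsionH1ToH1 (W.baseChange K) (m : ℤ) D.b' = torsionH1ToH1 (W.baseChange K) _ (conjAct W σ' _ t) ∧
        ∃ S : Finset (Place K), ∀ v ∉ S, D.localTerm (LocalInvariants.canonical K (m * m)) v = 0) ∧
      ctGeneralFun (W.baseChange K) m e hμ hadd₁ hadd₂ hgal (LocalInvariants.canonical K (m * m))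
          (torsionH1ToH1 (W.baseChange K) _ (conjAct W σ' _ z)) (torsionH1ToH1 (W.baseChange K) _ (conjAct W σ' _ t)) =
        ctGeneralFun (W.baseChange K) m e hμ hadd₁ hadd₂ hgal (LocalInvariants.canonical K (m * m))
          (torsionH1ToH1 (W.baseChange K) _ z) (torsionH1ToH1 (W.baseChange K) _ t) := by
    rintro σ' z t ⟨D, hDb, hDb', S, hS⟩
    obtain ⟨D₂, hb, hb', hfin, hinf₂, hinf⟩ := exists_semilinearTransport (e₂ := e) (hμ₂ := hμ) (hadd₁₂ := hadd₁)
      (hadd₂₂ := hadd₂) (hgal₂ := hgal) hodd (isLiftOfAut_liftAut σ') halt (he σ') D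
    -- the permutation of the places
    let Φ : Place K → Place K := Sum.map id (σ' • ·)
    have hΦinj : Function.Injective Φ := Sum.map_injective.mpr ⟨fun _ _ h => h, MulAction.injective σ'⟩
    have hΦterm : ∀ v, D₂.localTerm (LocalInvariants.canonical K (m * m)) (Φ v) =
        D.localTerm (LocalInvariants.canonical K (m * m)) v := by
      rintro (w | v)
      · exact (hinf₂ w).trans (hinf w).symm
      · exact hfin v
    let S₁ : Finset (Place K) := S ∪ (Finset.univ : Finset (InfinitePlace K)).map ⟨Sum.inl, Sum.inl_injective⟩
    have hS₁ : ∀ v ∉ S₁, D.localTerm (LocalInvariants.canonical K (m * m)) v = 0 := fun v hv =>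
      hS v fun h => hv (Finset.mem_union_left _ h)
    have hS₂ : ∀ v ∉ S₁.image Φ, D₂.localTerm (LocalInvariants.canonical K (m * m)) v = 0 := by
      rintro (w | u) hv
      · exact hinf₂ w
      · have hu : Φ (Sum.inr (σ'⁻¹ • u)) = Sum.inr u := by
          change Sum.inr (σ' • (σ'⁻¹ • u)) = Sum.inr u
          rw [smul_inv_smul]
        rw [← hu, hΦterm]
        exact hS₁ _ fun hmem => hv (hu ▸ Finset.mem_image_of_mem Φ hmem)
    have hb₂ : torsionH1ToH1 (W.baseChange K) (m : ℤ) D₂.b = torsionH1ToH1 (W.baseChange K) _ (conjAct W σ' _ z) := by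
      rw [hb, torsionH1ToH1_conjAct, hDb, ← torsionH1ToH1_conjAct]
    have hb₂' : torsionH1ToH1 (W.baseChange K) (m : ℤ) D₂.b' = torsionH1ToH1 (W.baseChange K) _ (conjAct W σ' _ t) := by
      rw [hb', torsionH1ToH1_conjAct, hDb', ← torsionH1ToH1_conjAct]
    refine ⟨⟨D₂, hb₂, hb₂', _, hS₂⟩, ?_⟩
    rw [← hb₂, ← hb₂', ← hDb, ← hDb', ctGeneralFun_eq _ halt hPT' D₂ hS₂, ctGeneralFun_eq _ halt hPT' D hS₁,
      GeneralCaseData.sumOn, GeneralCaseData.sumOn, Finset.sum_image fun x _ y _ h => hΦinj h]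
    exact Finset.sum_congr rfl fun v _ => hΦterm v
  by_cases h : ∃ D : GeneralCaseData (W.baseChange K) m e hμ hadd₁ hadd₂ hgal,
      torsionH1ToH1 (W.baseChange K) (m : ℤ) D.b = torsionH1ToH1 (W.baseChange K) _ z ∧
      torsionH1ToH1 (W.baseChange K) (m : ℤ) D.b' = torsionH1ToH1 (W.baseChange K) _ t ∧
      ∃ S : Finset (Place K), ∀ v ∉ S, D.localTerm (LocalInvariants.canonical K (m * m)) v = 0
  · exact (transfer σ z t h).2
  · have h' : ¬ ∃ D : GeneralCaseData (W.baseChange K) m e hμ hadd₁ hadd₂ hgal,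
        torsionH1ToH1 (W.baseChange K) (m : ℤ) D.b = torsionH1ToH1 (W.baseChange K) _ (conjAct W σ _ z) ∧
        torsionH1ToH1 (W.baseChange K) (m : ℤ) D.b' = torsionH1ToH1 (W.baseChange K) _ (conjAct W σ _ t) ∧
        ∃ S : Finset (Place K), ∀ v ∉ S, D.localTerm (LocalInvariants.canonical K (m * m)) v = 0 := by
      intro h₂
      apply h
      have h₃ := (transfer σ⁻¹ _ _ h₂).1
      have hback : ∀ x : galH1Torsion (W.baseChange K) ((m * m : ℕ) : ℤ), conjAct W σ⁻¹ _ (conjAct W σ _ x) = x :=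
        fun x => by
        rw [← AddMonoidHom.comp_apply, ← conjAct_mul, inv_mul_cancel, conjAct_one, AddMonoidHom.id_apply]
      rwa [hback, hback] at h₃
    rw [ctGeneralFun_eq_zero_of_not _ h', ctGeneralFun_eq_zero_of_not _ h]

end Invariance

/-! ## The levelwise Cassels–Tate fact from `hPTc` and Poitou–Tate AT `E[p^{M₀}]` only -/

section LevelInputs

/-- **`casselsTate_levelInputs K` from Milne I 4.10(a) in cochain form (`hPTc`) and Poitou–Tate AT THE MODULES `E[p^{M₀}]`
(Howard (i) shape for THE maps) ONLY** — w3 g4's `casselsTate_levelInputs_of_hPTc_of_hconj_of_selmerComplementAt` (p619177) with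
its displayed hypothesis `hconj` (conjunct (v): `Aut(K/ℚ)`-invariance of `ctGeneralFun` on the `q²`-Selmer group, for THE maps)
DISCHARGED by `ctGeneralFun_conjAct_canonical` (`q = p^{M₀}` odd, `≥ 3`). Conjuncts (i) reciprocity, (ii) local duality,
(iii) `Ш³ = 0`, Lemma 6.15 and (v) of the named fact are now theorems / per-module Poitou–Tate for the canonical family; what
separates `CasselsTateLevelInputsFact` (stmt-20191) from a theorem is `hPTc` and Poitou–Tate at `E[p^{M₀}]`, `M₀ ≥ 2`.
[cite: MilneADT2006, Ch. I, Thm. 4.10(a)(b), §6 Prop. 6.9, Thm. 6.13] [cite: GrossLMS1991, §5 (5.1)]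
[cite: McCallumLMS1991, §5, Thm. 5.4, Thm. 5.8] -/
theorem casselsTate_levelInputs_of_hPTc_of_selmerComplementAt (K : Type) [Field K] [NumberField K]
    (hPTc : ∀ (W : WeierstrassCurve ℚ) [W.IsElliptic] (p M₀ : ℕ), p.Prime → p ≠ 2 → 1 ≤ M₀ →
      ∀ [NeZero (p ^ M₀)]
        (e : geomTorsion (W.baseChange K) ((p ^ M₀ * p ^ M₀ : ℕ) : ℤ) →
          geomTorsion (W.baseChange K) ((p ^ M₀ * p ^ M₀ : ℕ) : ℤ) → AlgebraicClosure K)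
        (hμ : ∀ S T, e S T ^ (p ^ M₀ * p ^ M₀) = 1)
        (hadd₁ : ∀ S₁ S₂ T, e (S₁ + S₂) T = e S₁ T * e S₂ T)
        (hadd₂ : ∀ S T₁ T₂, e S (T₁ + T₂) = e S T₁ * e S T₂)
        (hgal : ∀ (σ : absoluteGaloisGroup K)
          (S T : geomTorsion (W.baseChange K) ((p ^ M₀ * p ^ M₀ : ℕ) : ℤ)), σ • e S T = e (σ • S) (σ • T)),
        (∀ T, e T T = 1) → (∀ T, (∀ S, e S T = 1) → T = 0) →
        ∀ f : contTwoCocycles ((W.baseChange K).torsionGaloisModule ((p ^ M₀ : ℕ) : ℤ)).toTopRep,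
          (∀ g : contOneCocycles ((W.baseChange K).torsionGaloisModule ((p ^ M₀ : ℕ) : ℤ)).toTopRep,
            (∀ v : Place K, locClass ((W.baseChange K).torsionGaloisModule ((p ^ M₀ : ℕ) : ℤ))
                (Place.Completion v)
                (resOne ((W.baseChange K).torsionGaloisModule ((p ^ M₀ : ℕ) : ℤ)) (Place.Completion v) g) = 0) →
            ∃ (C : PTChoice (W.baseChange K) (p ^ M₀) e hμ hadd₁ hadd₂ hgal f g) (S : Finset (Place K)),
              (∀ v ∉ S, C.localTerm (LocalInvariants.canonical K (p ^ M₀ * p ^ M₀)) v = 0) ∧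
                ∑ v ∈ S, C.localTerm (LocalInvariants.canonical K (p ^ M₀ * p ^ M₀)) v = 0) →
          twoCocycleClass _ f = 0)
    (hSC : ∀ (W : WeierstrassCurve ℚ) [W.IsElliptic] (p M₀ : ℕ), p.Prime → p ≠ 2 → 1 ≤ M₀ →
      ∀ [NeZero (p ^ M₀)] [Finite ((W.baseChange K).geomTorsion ((p ^ M₀ : ℕ) : ℤ))] (S : Finset (Place K)),
      (∀ v : HeightOneSpectrum (𝓞 K), (Sum.inr v : Place K) ∉ S →
        ((p ^ M₀ : ℕ) : 𝓞 K) ∉ v.asIdeal ∧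
          GaloisRep.IsUnramifiedAt v ((W.baseChange K).torsionGaloisModule ((p ^ M₀ : ℕ) : ℤ))) →
      ∀ (𝓕 𝓖 : SelmerStructure ((W.baseChange K).torsionGaloisModule ((p ^ M₀ : ℕ) : ℤ))), 𝓕 ≤ 𝓖 →
        𝓕.IsUnramifiedOutside S → 𝓖.IsUnramifiedOutside S →
        ∀ t : Π v : Place K, galoisCohomology (((W.baseChange K).torsionGaloisModule ((p ^ M₀ : ℕ) : ℤ)).toLocal v) 1,
          (∀ v ∈ S, t v ∈ 𝓖 v) →
          (∀ y ∈ ((LocalInvariants.canonical K (p ^ M₀)).dualSelmerStructure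
              ((W.baseChange K).torsionGaloisModule ((p ^ M₀ : ℕ) : ℤ)) 𝓕).selmerGroup,
            ∑ v ∈ S, localTatePairingZMod ((W.baseChange K).torsionGaloisModule ((p ^ M₀ : ℕ) : ℤ)) (p ^ M₀) v
              (LocalInvariants.canonical K (p ^ M₀) v) (t v)
              (galoisCohomology.localization
                (((W.baseChange K).torsionGaloisModule ((p ^ M₀ : ℕ) : ℤ)).tateDual (p ^ M₀)) v 1 y) = 0) →
          ∃ x ∈ 𝓖.selmerGroup, ∀ v ∈ S,
            galoisCohomology.localization ((W.baseChange K).torsionGaloisModule ((p ^ M₀ : ℕ) : ℤ)) v 1 x - t v ∈ 𝓕 v) :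
    casselsTate_levelInputs K :=
  casselsTate_levelInputs_of_hPTc_of_hconj_of_selmerComplementAt K hPTc hSC
    (fun W _ p M₀ hp hp2 hM₀ _ c _ _ e hμ hadd₁ hadd₂ hgal halt _ z _ t _ =>
      ctGeneralFun_conjAct_canonical ((hp.odd_of_ne_two hp2).pow)
        (le_trans hp.two_le (Nat.le_self_pow (by omega) p)) halt c z t)

/-- **The same with the per-module input in Milne I 4.10(b) shape** (`Ker γ¹ ⊆ Im β¹` for `(W/K)[p^{M₀}]`, THE maps, every finite
`S ⊇ ∞` off which `p` and `E[p^{M₀}]` are unramified — the shape the Poitou–Tate lanes deliver per module), `hconj` discharged.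
[cite: MilneADT2006, Ch. I, Thm. 4.10(a)(b), §6 Prop. 6.9, Thm. 6.13] [cite: GrossLMS1991, §5 (5.1)] -/
theorem casselsTate_levelInputs_of_hPTc_of_middleExactAt (K : Type) [Field K] [NumberField K]
    (hPTc : ∀ (W : WeierstrassCurve ℚ) [W.IsElliptic] (p M₀ : ℕ), p.Prime → p ≠ 2 → 1 ≤ M₀ →
      ∀ [NeZero (p ^ M₀)]
        (e : geomTorsion (W.baseChange K) ((p ^ M₀ * p ^ M₀ : ℕ) : ℤ) →
          geomTorsion (W.baseChange K) ((p ^ M₀ * p ^ M₀ : ℕ) : ℤ) → AlgebraicClosure K)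
        (hμ : ∀ S T, e S T ^ (p ^ M₀ * p ^ M₀) = 1)
        (hadd₁ : ∀ S₁ S₂ T, e (S₁ + S₂) T = e S₁ T * e S₂ T)
        (hadd₂ : ∀ S T₁ T₂, e S (T₁ + T₂) = e S T₁ * e S T₂)
        (hgal : ∀ (σ : absoluteGaloisGroup K)
          (S T : geomTorsion (W.baseChange K) ((p ^ M₀ * p ^ M₀ : ℕ) : ℤ)), σ • e S T = e (σ • S) (σ • T)),
        (∀ T, e T T = 1) → (∀ T, (∀ S, e S T = 1) → T = 0) →
        ∀ f : contTwoCocycles ((W.baseChange K).torsionGaloisModule ((p ^ M₀ : ℕ) : ℤ)).toTopRep,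
          (∀ g : contOneCocycles ((W.baseChange K).torsionGaloisModule ((p ^ M₀ : ℕ) : ℤ)).toTopRep,
            (∀ v : Place K, locClass ((W.baseChange K).torsionGaloisModule ((p ^ M₀ : ℕ) : ℤ))
                (Place.Completion v)
                (resOne ((W.baseChange K).torsionGaloisModule ((p ^ M₀ : ℕ) : ℤ)) (Place.Completion v) g) = 0) →
            ∃ (C : PTChoice (W.baseChange K) (p ^ M₀) e hμ hadd₁ hadd₂ hgal f g) (S : Finset (Place K)),
              (∀ v ∉ S, C.localTerm (LocalInvariants.canonical K (p ^ M₀ * p ^ M₀)) v = 0) ∧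
                ∑ v ∈ S, C.localTerm (LocalInvariants.canonical K (p ^ M₀ * p ^ M₀)) v = 0) →
          twoCocycleClass _ f = 0)
    (hE : ∀ (W : WeierstrassCurve ℚ) [W.IsElliptic] (p M₀ : ℕ), p.Prime → p ≠ 2 → 1 ≤ M₀ →
      ∀ [NeZero (p ^ M₀)] [Finite ((W.baseChange K).geomTorsion ((p ^ M₀ : ℕ) : ℤ))] (S : Finset (Place K)),
      (∀ w : InfinitePlace K, (Sum.inl w : Place K) ∈ S) →
      (∀ v : HeightOneSpectrum (𝓞 K), (Sum.inr v : Place K) ∉ S →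
        ((p ^ M₀ : ℕ) : 𝓞 K) ∉ v.asIdeal ∧
          GaloisRep.IsUnramifiedAt v ((W.baseChange K).torsionGaloisModule ((p ^ M₀ : ℕ) : ℤ))) →
      ∀ t : Π v : Place K, galoisCohomology (((W.baseChange K).torsionGaloisModule ((p ^ M₀ : ℕ) : ℤ)).toLocal v) 1,
        (∀ y : galoisCohomology (((W.baseChange K).torsionGaloisModule ((p ^ M₀ : ℕ) : ℤ)).tateDual (p ^ M₀)) 1,
          (∀ v : HeightOneSpectrum (𝓞 K), (Sum.inr v : Place K) ∉ S →
            galoisCohomology.localization (((W.baseChange K).torsionGaloisModule ((p ^ M₀ : ℕ) : ℤ)).tateDual (p ^ M₀))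
                (Sum.inr v) 1 y ∈
              unramifiedSubgroup (GaloisRep.toLocal v
                (((W.baseChange K).torsionGaloisModule ((p ^ M₀ : ℕ) : ℤ)).tateDual (p ^ M₀))) 1) →
          ∑ v ∈ S, localTatePairingZMod ((W.baseChange K).torsionGaloisModule ((p ^ M₀ : ℕ) : ℤ)) (p ^ M₀) v
            (LocalInvariants.canonical K (p ^ M₀) v) (t v)
            (galoisCohomology.localization
              (((W.baseChange K).torsionGaloisModule ((p ^ M₀ : ℕ) : ℤ)).tateDual (p ^ M₀)) v 1 y) = 0) →
        ∃ x : galoisCohomology ((W.baseChange K).torsionGaloisModule ((p ^ M₀ : ℕ) : ℤ)) 1,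
          (∀ v : HeightOneSpectrum (𝓞 K), (Sum.inr v : Place K) ∉ S →
            galoisCohomology.localization ((W.baseChange K).torsionGaloisModule ((p ^ M₀ : ℕ) : ℤ)) (Sum.inr v) 1 x ∈
              unramifiedSubgroup (GaloisRep.toLocal v ((W.baseChange K).torsionGaloisModule ((p ^ M₀ : ℕ) : ℤ))) 1) ∧
          ∀ v ∈ S, galoisCohomology.localization ((W.baseChange K).torsionGaloisModule ((p ^ M₀ : ℕ) : ℤ)) v 1 x = t v) :
    casselsTate_levelInputs K :=
  casselsTate_levelInputs_of_hPTc_of_hconj_of_middleExactAt K hPTc hE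
    (fun W _ p M₀ hp hp2 hM₀ _ c _ _ e hμ hadd₁ hadd₂ hgal halt _ z _ t _ =>
      ctGeneralFun_conjAct_canonical ((hp.odd_of_ne_two hp2).pow)
        (le_trans hp.two_le (Nat.le_self_pow (by omega) p)) halt c z t)

end LevelInputs

end Summit.BirchSwinnertonDyer.BirchSwinnertonDyer.Theorems.CasselsTateConj

end
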